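import Summits.ResolutionOfSingularities.ResolutionOfSingularities.Theorems.FrobeniusClosingDefs
import Literature.AlgebraicGeometry.Resolution.AdicNoetherian
import Literature.RingTheory.MvPowerSeries.MaximalIdealPow

/-!
# Crux `ClosingReduction`, line `chart-factorization`: stub `stub_loewyKit` — the Loewy bound
# `𝔪 ^ β ≤ jac c` versus the Milnor algebra, and its Diophantine description on the jet

Crux `ClosingReduction` (stmt-ResolutionOfSingularities-16347) of route `FrobeniusClosing`, line
`chart-factorization` (`Cruxes/ClosingReduction/Lines/chart_factorization.lean`), registered stub
`stub_loewyKit : LoewyKit` (the statement `LoewyKit` is in `Theorems/FrobeniusClosingDefs.lean`).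
With `R = K⟦u₁,…,uₙ⟧`, `𝔪` its maximal ideal, `jac c = (∂₁ a, …, ∂ₙ a)` the Jacobian ideal of the
cleaned series `a = ser c`, `A = R ⧸ jac c` the Milnor algebra, `Isol c := Module.Finite K A`,
`mu c := finrank_K A`, `JacPow β c := 𝔪 ^ β ≤ jac c`:

1. `LoewyKitProof.jacPow_of_isol_of_mu_le` : `Isol c → mu c ≤ β → JacPow β c`. The `𝔪`-adic
   filtration `V k = 𝔪 ^ k · A` of the finite-dimensional `K`-space `A` is strictly decreasing as
   long as it is non-zero (a stationary step `𝔪 · V k = V k` gives `V k = 0` by Nakayama, `V k`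
   being finitely generated over the Noetherian ring `R`), so `dim_K V k + k ≤ dim_K A` or
   `V k = 0`; hence `V (mu c) = 0`, i.e. `𝔪 ^ β` annihilates `A = R ⧸ jac c` for `β ≥ mu c`.
2. `LoewyKitProof.isol_of_jacPow` : `JacPow β c → Isol c`, since `A` is then a quotient of the
   finite-dimensional jet algebra `R ⧸ 𝔪 ^ β`
   (`Literature.RingTheory.MvPowerSeries.Jets.finite_quotient_maximalIdeal_pow`).
3. `LoewyKitProof.jacPow_iff_exists_aeval` : the Loewy bound is DIOPHANTINE ON THE `(β+1)`-JET,
   uniformly in the field. First (`jacPow_iff_forall_exists_multipliers`, Nakayama again, with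
   `𝔪 ^ β = (u^m : |m| = β)` finitely generated): `𝔪 ^ β ≤ jac c` iff for every `|m| = β` there
   are multipliers `H₁, …, Hₙ` with `coeff_A (∑ᵢ Hᵢ ∂ᵢ a) = [A = m]` for all `|A| ≤ β` (i.e.
   `u^m ≡ ∑ᵢ Hᵢ ∂ᵢ a (mod 𝔪 ^ (β+1))`). This condition is bilinear in the coefficients of the `Hᵢ`
   in degree `≤ β` (the witness block `w`, indexed by `(m, i, d)` through `Fintype.equivFin`) and
   the cleaned coefficients of `a` in degree `≤ β + 1` (`coeff_sum_mul_pd`,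
   `coeff_A' (∂ᵢ a) = (A'ᵢ + 1) a_{A' + eᵢ}`), which are the recorded jet coordinates `code e c` —
   a monomial of degree `≤ β + 1` that is not recorded is a `p`-th power, where cleaned
   coefficients vanish (`aeval_jetVar`). The system `G ⊆ (ℤ/p)[X ⊕ W]` consists of the
   polynomials `E(m, A) = ∑ᵢ ∑_{d + A' = A} W_{m,i,d} (A'ᵢ + 1) X_{A' + eᵢ} − [A = m]`.

No characteristic or perfectness hypothesis enters (the hypotheses `p.Prime`, `0 < n` of
`LoewyKit` (3) are not used). Sources: Nakayama's lemma (Matsumura, *Commutative Ring Theory*,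
Thm 2.2); the Loewy-length argument is standard (e.g. Greuel–Lossen–Shustin, *Introduction to
Singularities and Deformations*, proof of Thm I.2.1 / Cor I.2.24).
-/

noncomputable section

-- single-problem summit: the doubled namespace component is forced
set_option linter.dupNamespace false

open scoped BigOperators Classical

open IsLocalRing

namespace Summit.ResolutionOfSingularities.ResolutionOfSingularities.Theorems.FrobeniusClosing

namespace LoewyKitProof

open Literature.RingTheory.MvPowerSeries.Jets

variable (p n : ℕ) (K : Type) [Field K] (c : (Fin n → ℕ) → K)

/-- **`LoewyKit` (2).** The Loewy bound `𝔪 ^ β ≤ jac c` makes the Milnor algebra a quotient of the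
finite-dimensional jet algebra `K⟦u⟧ ⧸ 𝔪 ^ β`, hence finite over `K`. [folklore] -/
theorem isol_of_jacPow (β : ℕ) (h : JacPow p n K β c) : Isol p n K c := by
  unfold Isol
  unfold JacPow at h
  haveI := finite_quotient_maximalIdeal_pow (σ := Fin n) (K := K) β
  exact Module.Finite.of_surjective (Ideal.Quotient.factorₐ K h).toLinearMap
    (Ideal.Quotient.factor_surjective h)

/-- **`LoewyKit` (1).** In the finite-dimensional Milnor algebra `A = K⟦u⟧ ⧸ jac c` the `𝔪`-adic
filtration `A ⊇ 𝔪A ⊇ 𝔪²A ⊇ ⋯` is strictly decreasing until it vanishes (Nakayama), so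
`𝔪 ^ (dim_K A) · A = 0`, i.e. `𝔪 ^ β ≤ jac c` for every `β ≥ mu c`. [folklore] -/
theorem jacPow_of_isol_of_mu_le (β : ℕ) (hI : Isol p n K c) (hμ : mu p n K c ≤ β) :
    JacPow p n K β c := by
  unfold JacPow
  unfold Isol at hI
  unfold mu at hμ
  set J : Ideal (MvPowerSeries (Fin n) K) := jac p n K c
  haveI : Module.Finite K (MvPowerSeries (Fin n) K ⧸ J) := hI
  haveI : IsNoetherianRing (MvPowerSeries (Fin n) K) :=
    Literature.AlgebraicGeometry.Resolution.isNoetherianRing_mvPowerSeries K (Fin n)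
  -- the `𝔪`-adic filtration of the Milnor algebra, as `K`-subspaces
  let V : ℕ → Submodule K (MvPowerSeries (Fin n) K ⧸ J) := fun k =>
    ((maximalIdeal (MvPowerSeries (Fin n) K) ^ k) •
      (⊤ : Submodule (MvPowerSeries (Fin n) K) (MvPowerSeries (Fin n) K ⧸ J))).restrictScalars K
  have hV0 : V 0 = ⊤ := by
    show ((maximalIdeal (MvPowerSeries (Fin n) K) ^ 0) •
      (⊤ : Submodule (MvPowerSeries (Fin n) K) (MvPowerSeries (Fin n) K ⧸ J))).restrictScalars K = ⊤
    rw [pow_zero, Ideal.one_eq_top, Submodule.top_smul, Submodule.restrictScalars_top]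
  have hanti : ∀ k, V (k + 1) ≤ V k := fun k =>
    Submodule.restrictScalars_mono K
      (Submodule.smul_mono_left (Ideal.pow_le_pow_right (Nat.le_succ k)))
  -- Nakayama: a stationary step kills the filtration
  have hnak : ∀ k, V (k + 1) = V k → V k = ⊥ := by
    intro k hk
    have hk' : (maximalIdeal (MvPowerSeries (Fin n) K) ^ (k + 1)) •
        (⊤ : Submodule (MvPowerSeries (Fin n) K) (MvPowerSeries (Fin n) K ⧸ J)) =
        (maximalIdeal (MvPowerSeries (Fin n) K) ^ k) • ⊤ :=
      (Submodule.restrictScalars_inj K _ _).1 hk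
    rw [Submodule.restrictScalars_eq_bot_iff]
    refine Submodule.eq_bot_of_le_smul_of_le_jacobson_bot (maximalIdeal _) _
      (IsNoetherian.noetherian _) ?_ (maximalIdeal_le_jacobson _)
    rw [← Submodule.mul_smul, ← pow_succ', hk']
  -- the chain is strict while non-zero, so the dimension drops by one at each step
  have hchain : ∀ k, V k = ⊥ ∨
      Module.finrank K (V k) + k ≤ Module.finrank K (MvPowerSeries (Fin n) K ⧸ J) := by
    intro k
    induction k with
    | zero =>
      right
      rw [hV0, finrank_top, add_zero]
    | succ k ih =>
      rcases ih with h0 | hle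
      · left
        exact le_bot_iff.1 (h0 ▸ hanti k)
      · by_cases heq : V (k + 1) = V k
        · left
          rw [heq]
          exact hnak k heq
        · right
          have hlt : Module.finrank K (V (k + 1)) < Module.finrank K (V k) :=
            Submodule.finrank_lt_finrank_of_lt (lt_of_le_of_ne (hanti k) heq)
          omega
  have hVμ : V (Module.finrank K (MvPowerSeries (Fin n) K ⧸ J)) = ⊥ := by
    rcases hchain (Module.finrank K (MvPowerSeries (Fin n) K ⧸ J)) with h | h
    · exact h
    · have h0 : Module.finrank K (V (Module.finrank K (MvPowerSeries (Fin n) K ⧸ J))) = 0 := by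
        omega
      exact Submodule.finrank_eq_zero.1 h0
  have hVβ : V β = ⊥ :=
    le_bot_iff.1 (hVμ ▸ antitone_nat_of_succ_le hanti hμ)
  -- conclusion: `𝔪 ^ β` annihilates `A = K⟦u⟧ ⧸ jac c`, whose annihilator is `jac c`
  have hann := Submodule.le_annihilator_iff.2 ((Submodule.restrictScalars_eq_bot_iff K _ _).1 hVβ)
  rwa [Submodule.annihilator_top, Ideal.annihilator_quotient] at hann

/-! ### The Loewy bound on the jet: `𝔪 ^ β ≤ jac c` is bilinear-Diophantine -/

/-- Coefficients of the partials of the cleaned series: `coeff_A (∂_i a) = (A_i + 1) · a_{A + e_i}`.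
[folklore] -/
theorem coeff_pd_ser (i : Fin n) (A : Fin n →₀ ℕ) :
    MvPowerSeries.coeff A (pd n K i (ser p n K c)) =
      ((A i + 1 : ℕ) : K) * clean p n K c ⇑(A + Finsupp.single i 1 : Fin n →₀ ℕ) :=
  rfl

/-- The coefficient of `∑ᵢ Hᵢ · ∂ᵢ a` at `A` is bilinear in the coefficients of the multipliers
`Hᵢ` and the cleaned coefficients of `a` of total degree `≤ |A| + 1`. [folklore] -/
theorem coeff_sum_mul_pd (H : Fin n → MvPowerSeries (Fin n) K) (A : Fin n →₀ ℕ) :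
    MvPowerSeries.coeff A (∑ i, H i * pd n K i (ser p n K c)) =
      ∑ i, ∑ x ∈ Finset.HasAntidiagonal.antidiagonal A, MvPowerSeries.coeff x.1 (H i) *
        (((x.2 i + 1 : ℕ) : K) * clean p n K c ⇑(x.2 + Finsupp.single i 1 : Fin n →₀ ℕ)) := by
  rw [map_sum]
  refine Finset.sum_congr rfl fun i _ => ?_
  rw [MvPowerSeries.coeff_mul]
  rfl

/-- **The Loewy bound through multipliers, modulo `𝔪 ^ (β + 1)` (Nakayama).** `𝔪 ^ β ≤ jac c` iff
every monomial `u^m` of degree `β` is `∑ᵢ Hᵢ ∂ᵢ a` up to terms of degree `> β`, i.e. iff for every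
such `m` there are multipliers `H` with `coeff_A (∑ᵢ Hᵢ ∂ᵢ a) = [A = m]` for all `|A| ≤ β`
(`⇒`: `u^m ∈ jac c` exactly; `⇐`: `𝔪 ^ β ≤ jac c + 𝔪 · 𝔪 ^ β`, and `𝔪 ^ β` is finitely generated).
[folklore] -/
theorem jacPow_iff_forall_exists_multipliers (β : ℕ) :
    JacPow p n K β c ↔ ∀ m : Fin n →₀ ℕ, m.degree = β →
      ∃ H : Fin n → MvPowerSeries (Fin n) K, ∀ A : Fin n →₀ ℕ, A.degree ≤ β →
        MvPowerSeries.coeff A (∑ i, H i * pd n K i (ser p n K c)) = if A = m then 1 else 0 := by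
  unfold JacPow
  constructor
  · intro h m hm
    have hmem : MvPowerSeries.monomial m (1 : K) ∈ jac p n K c :=
      h (monomial_mem_maximalIdeal_pow hm.ge 1)
    unfold jac at hmem
    obtain ⟨H, hH⟩ := Ideal.mem_span_range_iff_exists_fun.1 hmem
    refine ⟨H, fun A _ => ?_⟩
    rw [hH, MvPowerSeries.coeff_monomial]
  · intro h
    haveI : IsNoetherianRing (MvPowerSeries (Fin n) K) :=
      Literature.AlgebraicGeometry.Resolution.isNoetherianRing_mvPowerSeries K (Fin n)
    -- every monomial of degree `β` lies in `jac c + 𝔪 ^ (β + 1)`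
    have hgen : ∀ m : Fin n →₀ ℕ, m.degree = β → MvPowerSeries.monomial m (1 : K) ∈
        jac p n K c ⊔ maximalIdeal (MvPowerSeries (Fin n) K) ^ (β + 1) := by
      intro m hm
      obtain ⟨H, hH⟩ := h m hm
      have hP : MvPowerSeries.monomial m (1 : K) - ∑ i, H i * pd n K i (ser p n K c) ∈
          maximalIdeal (MvPowerSeries (Fin n) K) ^ (β + 1) := by
        refine mem_maximalIdeal_pow_of_coeff_eq_zero fun A hA => ?_
        rw [map_sub, hH A (Nat.lt_succ_iff.1 hA), MvPowerSeries.coeff_monomial, sub_self]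
      have hJ : ∑ i, H i * pd n K i (ser p n K c) ∈ jac p n K c :=
        Ideal.sum_mem _ fun i _ => Ideal.mul_mem_left _ _ (Ideal.subset_span ⟨i, rfl⟩)
      have := Submodule.add_mem_sup hJ hP
      rwa [add_sub_cancel] at this
    have hle : maximalIdeal (MvPowerSeries (Fin n) K) ^ β ≤ jac p n K c ⊔
        maximalIdeal (MvPowerSeries (Fin n) K) • maximalIdeal (MvPowerSeries (Fin n) K) ^ β := by
      conv_lhs => rw [maximalIdeal_pow_eq_span_monomial β]
      rw [Ideal.span_le]
      rintro _ ⟨m, hm, rfl⟩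
      rw [Ideal.smul_eq_mul, ← pow_succ']
      exact hgen m hm
    exact Submodule.le_of_le_smul_of_le_jacobson_bot (IsNoetherian.noetherian _)
      (maximalIdeal_le_jacobson _) hle

/-- Evaluation of a JET VARIABLE: at the code of `c`, the variable recording the monomial `B` (or
`0` if `B` is not recorded) evaluates to the cleaned coefficient `clean c B`, for every `B` of total
degree `≤ β + 1` — unrecorded such `B` are `p`-th powers, where cleaned coefficients vanish.
[folklore] -/
theorem aeval_jetVar {N : ℕ} (e : Fin N → (Fin n → ℕ)) (β : ℕ)
    (hcover : ∀ A : Fin n → ℕ, Finset.sum Finset.univ (fun j => A j) ≤ β + 1 → (¬ ∀ j, p ∣ A j) →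
      ∃ s, e s = A)
    {M : ℕ} [Algebra (ZMod p) K] (w : Fin M → K) (B : Fin n → ℕ)
    (hB : Finset.sum Finset.univ (fun j => B j) ≤ β + 1) :
    MvPolynomial.aeval (Sum.elim (code p n K e c) w)
      (if h : ∃ s, e s = B then MvPolynomial.X (Sum.inl h.choose) else 0 :
        MvPolynomial (Fin N ⊕ Fin M) (ZMod p)) = clean p n K c B := by
  by_cases h : ∃ s, e s = B
  · rw [dif_pos h, MvPolynomial.aeval_X, Sum.elim_inl]
    unfold code
    rw [h.choose_spec]
  · rw [dif_neg h, map_zero]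
    by_cases hall : ∀ j, p ∣ B j
    · unfold clean
      rw [if_pos hall]
    · exact absurd (hcover B hB hall) h

/-- **`LoewyKit` (3).** The Loewy bound `𝔪 ^ β ≤ jac c` is DIOPHANTINE ON THE `(β+1)`-JET,
uniformly in the field: one finite system `G` over `ℤ/p` in the jet variables `X` and witness
variables `W` (the coefficients, in degree `≤ β`, of multipliers `H_{m,i}` with
`u^m ≡ ∑ᵢ H_{m,i} ∂ᵢ a (mod 𝔪 ^ (β+1))` for every `|m| = β`) with
`𝔪 ^ β ≤ jac c ↔ ∃ w, G (code e c, w) = 0`. [folklore] -/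
theorem jacPow_iff_exists_aeval (p n β N : ℕ) (e : Fin N → (Fin n → ℕ))
    (hcover : ∀ A : Fin n → ℕ, Finset.sum Finset.univ (fun j => A j) ≤ β + 1 → (¬ ∀ j, p ∣ A j) →
      ∃ s, e s = A) :
    ∃ (M : ℕ) (G : Finset (MvPolynomial (Fin N ⊕ Fin M) (ZMod p))),
      ∀ (K : Type) [Field K] [Algebra (ZMod p) K] (c : (Fin n → ℕ) → K),
        JacPow p n K β c ↔
          ∃ w : Fin M → K, ∀ g ∈ G, MvPolynomial.aeval (Sum.elim (code p n K e c) w) g = 0 := by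
  -- the finitely many exponents of degree `≤ β`
  set S : Finset (Fin n →₀ ℕ) := (Finsupp.finite_of_degree_le β).toFinset with hSdef
  have hS : ∀ d : Fin n →₀ ℕ, d ∈ S ↔ d.degree ≤ β := fun d => by
    rw [hSdef, Set.Finite.mem_toFinset, Set.mem_setOf_eq]
  -- witness variables: (target `m`, direction `i`, multiplier exponent `d`)
  obtain ⟨M, ⟨ε⟩⟩ : ∃ M : ℕ, Nonempty ((↥S × Fin n × ↥S) ≃ Fin M) :=
    ⟨Fintype.card (↥S × Fin n × ↥S), ⟨Fintype.equivFin _⟩⟩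
  let P : Type := MvPolynomial (Fin N ⊕ Fin M) (ZMod p)
  let jet : (Fin n → ℕ) → P := fun B =>
    if h : ∃ s, e s = B then MvPolynomial.X (Sum.inl h.choose) else 0
  let Wv : ↥S → Fin n → (Fin n →₀ ℕ) → P := fun m i d =>
    if h : d.degree ≤ β then MvPolynomial.X (Sum.inr (ε (m, i, ⟨d, (hS d).2 h⟩))) else 0
  let E : ↥S → ↥S → P := fun m A =>
    if (m : Fin n →₀ ℕ).degree = β then
      (∑ i : Fin n, ∑ x ∈ Finset.HasAntidiagonal.antidiagonal (A : Fin n →₀ ℕ),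
          Wv m i x.1 * (((x.2 i + 1 : ℕ) : P) * jet ⇑(x.2 + Finsupp.single i 1 : Fin n →₀ ℕ))) -
        (if (A : Fin n →₀ ℕ) = m then 1 else 0)
    else 0
  refine ⟨M, Finset.univ.image (fun mA : ↥S × ↥S => E mA.1 mA.2), ?_⟩
  intro K _ _ c
  -- evaluation of the equation `E m A` at `(code c, w)` when `w` tabulates the multipliers `H`
  have hE : ∀ (w : Fin M → K) (m A : ↥S), (m : Fin n →₀ ℕ).degree = β →
      ∀ H : Fin n → MvPowerSeries (Fin n) K,
        (∀ (i : Fin n) (d : Fin n →₀ ℕ) (hd : d.degree ≤ β),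
            MvPowerSeries.coeff d (H i) = w (ε (m, i, ⟨d, (hS d).2 hd⟩))) →
        MvPolynomial.aeval (Sum.elim (code p n K e c) w) (E m A) =
          MvPowerSeries.coeff (A : Fin n →₀ ℕ) (∑ i, H i * pd n K i (ser p n K c)) -
            (if (A : Fin n →₀ ℕ) = m then 1 else 0) := by
    intro w m A hm H hH
    have hA : (A : Fin n →₀ ℕ).degree ≤ β := (hS A).1 A.2
    rw [coeff_sum_mul_pd]
    simp only [E, jet, if_pos hm, map_sub, map_sum, map_mul, map_natCast]
    congr 1
    · refine Finset.sum_congr rfl fun i _ => Finset.sum_congr rfl fun x hx => ?_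
      have hdeg : x.1.degree + x.2.degree = (A : Fin n →₀ ℕ).degree := by
        rw [← map_add, Finset.HasAntidiagonal.mem_antidiagonal.1 hx]
      have hx1 : x.1.degree ≤ β := by omega
      have hx2 : Finset.sum Finset.univ
          (fun j => (⇑(x.2 + Finsupp.single i 1 : Fin n →₀ ℕ)) j) ≤ β + 1 := by
        rw [← Finsupp.degree_eq_sum, map_add, Finsupp.degree_single]
        omega
      rw [aeval_jetVar p n K c e β hcover w _ hx2, hH i x.1 hx1]
      simp only [Wv, dif_pos hx1, MvPolynomial.aeval_X, Sum.elim_inr]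
    · split_ifs <;> simp
  rw [jacPow_iff_forall_exists_multipliers]
  simp only [Finset.forall_mem_image, Finset.mem_univ, true_implies, Prod.forall]
  constructor
  · -- tabulate the coefficients of the multipliers
    intro h
    choose! H hH using h
    refine ⟨fun j =>
      MvPowerSeries.coeff ((ε.symm j).2.2 : Fin n →₀ ℕ) (H (ε.symm j).1 (ε.symm j).2.1),
      fun m A => ?_⟩
    by_cases hm : (m : Fin n →₀ ℕ).degree = β
    · rw [hE _ m A hm (H m) (fun i d hd => by simp only [Equiv.symm_apply_apply]),
        hH m hm A ((hS A).1 A.2), sub_self]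
    · simp only [E, if_neg hm, map_zero]
  · -- read the multipliers off the witness block
    rintro ⟨w, hw⟩ m hm
    let H : Fin n → MvPowerSeries (Fin n) K := fun i =>
      ∑ d : ↥S, w (ε (⟨m, (hS m).2 hm.le⟩, i, d)) • MvPowerSeries.monomial (d : Fin n →₀ ℕ) (1 : K)
    refine ⟨H, fun A hA => ?_⟩
    have key := hE w ⟨m, (hS m).2 hm.le⟩ ⟨A, (hS A).2 hA⟩ hm H (fun i d hd => by
      simp only [H, map_sum, map_smul, MvPowerSeries.coeff_monomial, smul_eq_mul, mul_ite,
        mul_one, mul_zero]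
      rw [Finset.sum_eq_single ⟨d, (hS d).2 hd⟩]
      · rw [if_pos rfl]
      · intro b _ hb
        rw [if_neg]
        intro hdb
        exact hb (Subtype.ext hdb.symm)
      · intro habs
        exact absurd (Finset.mem_univ _) habs)
    rw [hw] at key
    exact (sub_eq_zero.1 key.symm)

end LoewyKitProof

/-- **STUB `stub_loewyKit`** (line `chart-factorization` of crux `ClosingReduction`): the Loewy
bound versus the Milnor algebra — (1) `Isol c → mu c ≤ β → 𝔪 ^ β ≤ jac c`, (2)
`𝔪 ^ β ≤ jac c → Isol c`, (3) `𝔪 ^ β ≤ jac c` is Diophantine on the `(β+1)`-jet, uniformly in the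
field `K ⊇ ℤ/p`. See `LoewyKit` and the module docstring. [folklore] -/
theorem stub_loewyKit : LoewyKit :=
  ⟨fun p n K _ c β hI hμ => LoewyKitProof.jacPow_of_isol_of_mu_le p n K c β hI hμ,
    fun p n K _ c β h => LoewyKitProof.isol_of_jacPow p n K c β h,
    fun p _ n _ β N e hcover => LoewyKitProof.jacPow_iff_exists_aeval p n β N e hcover⟩

end Summit.ResolutionOfSingularities.ResolutionOfSingularities.Theorems.FrobeniusClosing

end
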